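import Literature.AlgebraicGeometry.Resolution.SmoothDescentCotangent
import Mathlib.RingTheory.Unramified.LocalStructure
import Mathlib.RingTheory.Polynomial.Quotient
import Mathlib.RingTheory.Smooth.Flat
import HarnessLib

/-!
# Standard étale algebras over polynomial rings: a Koszul presentation, `T ⊗_S H₁(L_{S/R}) = 0`

Topic: `Literature/AlgebraicGeometry/Resolution` (commutative algebra for `SmoothDescent.lean`).
By Mathlib's local structure theorem (`Algebra.IsSmoothAt.exists_isStandardEtale_mvPolynomial`,
Stacks 00UE and 054L) a smooth algebra is, locally, STANDARD ÉTALE over a polynomial ring: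
`T = S[X₁, …, Xₙ][t][Y]/(f(t), Y g(t) - 1)` with `f` monic. This file PROVES:

* `IsKoszulPair`, `IsKoszulPair.of_isRegular`, `isKoszulPair_standardEtale` — the relations
  `(f, Y g - 1)` form a regular sequence in `A[t][Y]` (`f` monic is a non-zero-divisor; `Y g - 1`
  is a non-zero-divisor modulo `f`, i.e. in `(A[t]/f)[Y]`), hence a KOSZUL PAIR: every syzygy
  `a f + b (Yg - 1) = 0` is a multiple of the Koszul syzygy.
* `inf_sq_le_mul_of_isKoszulPair` — if `π : 𝒬 → 𝒬₀` is surjective with kernel `𝔞` and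
  `p, q ∈ 𝒬` map to a Koszul pair, then `J = 𝔞 + (p, q)` satisfies `𝔞 ∩ J² ⊆ 𝔞·J` (the Koszul
  syzygy lifts on the nose), i.e. the hypothesis of
  `CotangentInjectivity.liftBaseChange_cotangent_injective` (`SmoothDescentCotangent.lean`);
  `CotangentInjectivity.kos_of_isKoszulPair` packages this for composite presentations.
* `StandardEtaleKoszul.presentation`, `ker_presentation_koszul` — the presentation of a standard
  étale `S[X₁,…,Xₙ]`-algebra over `S` (Mathlib's `StandardEtalePresentation.toPresentation`
  composed with the relation-free presentation of the polynomial ring) has kernel generated by a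
  Koszul pair (transported along `S[X, t, Y] ≃ S[X][t][Y]`).
* `StandardEtaleKoszul.subsingleton_tensor_h1Cotangent` — **for `T` standard étale over
  `S[X₁, …, Xₙ]` and formally smooth over `R`, `T ⊗_S H₁(L_{S/R}) = 0`** (the left end of the
  Jacobi–Zariski sequence of `R → S → T` is injective and `H₁(L_{T/R}) = 0`).

## Sources

* The Stacks Project, Tags 00S2, 00UE, 05B5; folklore (Koszul complex of a regular sequence of
  length two).
-/

noncomputable section

open KaehlerDifferential Module TensorProduct
open scoped Polynomial.Bivariate

namespace Literature.AlgebraicGeometry.Resolution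

section KoszulPair

open Polynomial

/-- A pair `(p, q)` of elements of a commutative ring whose module of syzygies is generated by
the Koszul syzygy `(-q, p)`: every relation `a p + b q = 0` is `(a, b) = e · (-q, p)`. For a
regular sequence of length two this holds (`IsKoszulPair.of_isRegular`). [folklore] -/
def IsKoszulPair {A : Type*} [CommRing A] (p q : A) : Prop :=
  ∀ a b : A, a * p + b * q = 0 → ∃ e : A, a = -(e * q) ∧ b = e * p

/-- A regular sequence `(p, q)` of length two — `p` a non-zero-divisor and `q` a
non-zero-divisor modulo `p` — is a Koszul pair. [folklore] -/
theorem IsKoszulPair.of_isRegular {A : Type*} [CommRing A] {p q : A} (hp : IsRegular p)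
    (hq : ∀ b : A, b * q ∈ Ideal.span {p} → b ∈ Ideal.span {p}) : IsKoszulPair p q := by
  intro a b hab
  have hbq : b * q ∈ Ideal.span {p} := by
    rw [Ideal.mem_span_singleton']
    exact ⟨-a, by linear_combination -hab⟩
  obtain ⟨e, rfl⟩ := Ideal.mem_span_singleton'.mp (hq b hbq)
  refine ⟨e, ?_, rfl⟩
  have h1 : p * (a + e * q) = 0 := by linear_combination hab
  have h2 : a + e * q = 0 := (hp.left.mul_left_eq_zero_iff).mp h1
  linear_combination h2

/-- Koszul pairs are transported by ring isomorphisms. [folklore] -/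
theorem IsKoszulPair.map_ringEquiv {A B : Type*} [CommRing A] [CommRing B] {p q : A}
    (h : IsKoszulPair p q) (e : A ≃+* B) : IsKoszulPair (e p) (e q) := by
  intro a b hab
  obtain ⟨c, hc1, hc2⟩ := h (e.symm a) (e.symm b) (e.injective (by simpa using hab))
  refine ⟨e c, ?_, ?_⟩
  · have := congrArg e hc1; simpa using this
  · have := congrArg e hc2; simpa using this

/-- In a polynomial ring, an element of the form `Y c - 1` is a non-zero-divisor: from
`(Y c - 1) h = 0` one gets `h = Y (c h)`, whence all coefficients of `h` vanish by induction.
[folklore] -/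
theorem isRegular_X_mul_C_sub_one {A : Type*} [CommRing A] (c : A) :
    IsRegular (X * C c - 1 : A[X]) := by
  have key : ∀ h : A[X], (X * C c - 1) * h = 0 → h = 0 := by
    intro h hmul
    have heq : h = X * (C c * h) := by linear_combination -hmul
    have hcoeff : ∀ k, h.coeff k = 0 := by
      intro k
      induction k with
      | zero => rw [heq, coeff_X_mul_zero]
      | succ k ih => rw [heq, coeff_X_mul, coeff_C_mul, ih, mul_zero]
    ext k
    simp [hcoeff k]
  refine ⟨isLeftRegular_of_non_zero_divisor _ key, isRightRegular_of_non_zero_divisor _ ?_⟩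
  intro h hmul
  exact key h (by rw [mul_comm]; exact hmul)

/-- `C` maps non-zero-divisors of `A` to non-zero-divisors of `A[X]`. [folklore] -/
theorem isRegular_C_of_isRegular {A : Type*} [CommRing A] {a : A} (ha : IsRegular a) :
    IsRegular (C a : A[X]) := by
  have key : ∀ h : A[X], C a * h = 0 → h = 0 := by
    intro h hmul
    ext k
    have := congrArg (fun p : A[X] => p.coeff k) hmul
    simp only [coeff_C_mul, coeff_zero] at this
    simpa using (ha.left.mul_left_eq_zero_iff).mp this
  refine ⟨isLeftRegular_of_non_zero_divisor _ key, isRightRegular_of_non_zero_divisor _ ?_⟩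
  intro h hmul
  exact key h (by rw [mul_comm]; exact hmul)

/-- **The defining relations of a standard étale algebra form a Koszul pair**: for `f` monic
in `A[X]` and any `g`, the pair `(f, Y g - 1)` in `A[X][Y]` is a regular sequence (`f` is a
non-zero-divisor, and `Y g - 1` is a non-zero-divisor modulo `f`, i.e. in `(A[X]/f)[Y]`), hence
a Koszul pair. [folklore] -/
theorem isKoszulPair_standardEtale {A : Type*} [CommRing A] {f : A[X]} (hf : f.Monic)
    (g : A[X]) : IsKoszulPair (C f : A[X][Y]) (Y * C g - 1) := by
  refine IsKoszulPair.of_isRegular (isRegular_C_of_isRegular hf.isRegular) fun b hb => ?_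
  -- reduce modulo `f`
  let φ : A[X][Y] →+* (A[X] ⧸ Ideal.span {f})[X] :=
    mapRingHom (Ideal.Quotient.mk (Ideal.span {f}))
  have hker : RingHom.ker φ = Ideal.span {C f} := by
    rw [ker_mapRingHom, Ideal.mk_ker, Ideal.map_span, Set.image_singleton]
  have hbq : φ b * φ (Y * C g - 1) = 0 := by
    rw [← map_mul, ← RingHom.mem_ker, hker]
    exact hb
  have hφq : φ (Y * C g - 1) = X * C (Ideal.Quotient.mk (Ideal.span {f}) g) - 1 := by
    simp [φ]
  rw [hφq] at hbq
  have hb0 : φ b = 0 :=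
    ((isRegular_X_mul_C_sub_one _).right.mul_right_eq_zero_iff).mp hbq
  rw [← RingHom.mem_ker, hker] at hb0
  exact hb0

/-! ### Ideal arithmetic: `𝔞 ∩ J² ⊆ 𝔞 J` for `J = 𝔞 + (p, q)` with `(p, q)` Koszul modulo `𝔞` -/

/-- If `π : Q → Q₀` is a surjective ring map with kernel `𝔞` and `p, q ∈ Q` map to a Koszul
pair of `Q₀`, then for `J = 𝔞 + (p, q)` one has `𝔞 ∩ J² ⊆ 𝔞·J`. (The Koszul syzygy lifts ON
THE NOSE: `(-q) p + p q = 0` in `Q`.) [folklore] -/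
theorem inf_sq_le_mul_of_isKoszulPair {Q Q₀ : Type*} [CommRing Q] [CommRing Q₀]
    (π : Q →+* Q₀) (hπ : Function.Surjective π) (p q : Q) (hK : IsKoszulPair (π p) (π q)) :
    RingHom.ker π ⊓ (RingHom.ker π ⊔ Ideal.span {p, q}) ^ 2 ≤
      RingHom.ker π * (RingHom.ker π ⊔ Ideal.span {p, q}) := by
  set 𝔞 := RingHom.ker π with h𝔞
  set F : Ideal Q := Ideal.span {p, q} with hF
  rintro x ⟨hx𝔞, hxJ⟩
  -- `J² ≤ 𝔞 J + F²`
  have hJ2 : (𝔞 ⊔ F) ^ 2 ≤ 𝔞 * (𝔞 ⊔ F) ⊔ F * F := by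
    have h1 : F * (𝔞 ⊔ F) = F * 𝔞 ⊔ F * F := Ideal.mul_sup F 𝔞 F
    rw [pow_two, Ideal.sup_mul, h1]
    refine sup_le le_sup_left (sup_le ?_ le_sup_right)
    rw [Ideal.mul_comm F 𝔞]
    exact le_sup_of_le_left (Ideal.mul_mono_right le_sup_right)
  obtain ⟨y, hy, z, hz, rfl⟩ := Submodule.mem_sup.mp (hJ2 hxJ)
  have hz𝔞 : z ∈ 𝔞 := by
    have : y + z - y ∈ 𝔞 := Ideal.sub_mem _ hx𝔞 (Ideal.mul_le_right hy)
    simpa using this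
  refine Ideal.add_mem _ hy ?_
  -- write `z = α p² + β p q + γ q p + δ q²`
  have hF2 : F * F = Ideal.span {p * p, p * q, q * p, q * q} := by
    rw [hF, Ideal.span_pair_mul_span_pair]
  rw [hF2] at hz
  obtain ⟨α, z₁, hz₁, rfl⟩ := Ideal.mem_span_insert.mp hz
  obtain ⟨β, z₂, hz₂, rfl⟩ := Ideal.mem_span_insert.mp hz₁
  obtain ⟨γ, δ, rfl⟩ := Ideal.mem_span_pair.mp hz₂
  -- in `Q₀`: `(ᾱ p̄ + (β̄ + γ̄) q̄) p̄ + (δ̄ q̄) q̄ = 0`, a syzygy of `(p̄, q̄)`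
  have hsyz : (π α * π p + (π β + π γ) * π q) * π p + (π δ * π q) * π q = 0 := by
    have := hz𝔞
    rw [h𝔞, RingHom.mem_ker] at this
    rw [← this]
    simp only [map_add, map_mul]
    ring
  obtain ⟨ē, he1, he2⟩ := hK _ _ hsyz
  obtain ⟨e, rfl⟩ := hπ ē
  -- the lifted coefficients lie in `𝔞`
  have h1 : α * p + (β + γ) * q + e * q ∈ 𝔞 := by
    rw [h𝔞, RingHom.mem_ker]
    simp only [map_add, map_mul]
    rw [he1]; ring
  have h2 : δ * q - e * p ∈ 𝔞 := by
    rw [h𝔞, RingHom.mem_ker]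
    simp only [map_sub, map_mul]
    rw [he2]; ring
  have hpJ : p ∈ 𝔞 ⊔ F := Ideal.mem_sup_right (Ideal.subset_span (by simp))
  have hqJ : q ∈ 𝔞 ⊔ F := Ideal.mem_sup_right (Ideal.subset_span (by simp))
  have key : α * (p * p) + (β * (p * q) + (γ * (q * p) + δ * (q * q))) =
      (α * p + (β + γ) * q + e * q) * p + (δ * q - e * p) * q := by ring
  rw [key]
  exact Ideal.add_mem _ (Ideal.mul_mem_mul h1 hpJ) (Ideal.mul_mem_mul h2 hqJ)

end KoszulPair

namespace CotangentInjectivity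

universe w₁ w₂ u₁ u₂ u₃

variable {R : Type u₁} {S : Type u₂} [CommRing R] [CommRing S] [Algebra R S]
variable {T : Type u₃} [CommRing T] [Algebra R T] [Algebra S T] [IsScalarTower R S T]
variable {ι : Type w₁} {σ : Type w₂}
variable (Q : Algebra.Generators S T ι) (P : Algebra.Generators R S σ)

open Algebra Algebra.Generators

/-- If the kernel of `Q` is generated by a Koszul pair `(p, q)` of `S[X]`, then the composite
presentation satisfies `I·R[X,Y] ∩ J² ⊆ I·R[X,Y]·J`. [folklore] -/
theorem kos_of_isKoszulPair {p q : Q.Ring} (hker : Q.ker = Ideal.span {p, q})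
    (hK : IsKoszulPair p q) :
    P.ker.map (Q.toComp P).toAlgHom ⊓ (Q.comp P).ker ^ 2 ≤
      P.ker.map (Q.toComp P).toAlgHom * (Q.comp P).ker := by
  set π : (Q.comp P).Ring →+* Q.Ring := (Q.ofComp P).toAlgHom.toRingHom with hπdef
  have hπ : Function.Surjective π := Generators.toAlgHom_ofComp_surjective Q P
  obtain ⟨p', hp'⟩ := hπ p
  obtain ⟨q', hq'⟩ := hπ q
  have hkerπ : RingHom.ker π = P.ker.map (Q.toComp P).toAlgHom := by
    rw [Generators.map_toComp_ker]; rfl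
  have hJ : (Q.comp P).ker = RingHom.ker π ⊔ Ideal.span {p', q'} := by
    rw [Generators.ker_comp_eq_sup, hker, hkerπ]
    have hmap : Ideal.map π (Ideal.span {p', q'}) = Ideal.span {p, q} := by
      rw [Ideal.map_span, Set.image_pair, hp', hq']
    have hcomap : Ideal.comap (Q.ofComp P).toAlgHom (Ideal.span {p, q}) =
        Ideal.span {p', q'} ⊔ P.ker.map (Q.toComp P).toAlgHom := by
      rw [← hkerπ, ← hmap]
      exact Ideal.comap_map_of_surjective' π hπ _
    rw [hcomap, sup_comm (Ideal.span _), ← sup_assoc, sup_idem]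
  have hK' : IsKoszulPair (π p') (π q') := by rw [hp', hq']; exact hK
  have := inf_sq_le_mul_of_isKoszulPair π hπ p' q' hK'
  rw [← hJ, hkerπ] at this
  exact this

end CotangentInjectivity

/-! ### Standard étale algebras over polynomial rings have Koszul presentations -/

namespace StandardEtaleKoszul

universe u₁ u₂ u₃

variable {R : Type u₁} {S : Type u₂} [CommRing R] [CommRing S] [Algebra R S]
variable {T : Type u₃} [CommRing T] [Algebra R T] [Algebra S T] [IsScalarTower R S T]

open Algebra Algebra.Generators Polynomial


-- The presentation rings `P.toExtension.Ring` are `P.Ring` only up to unfolding `toExtension`;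
-- as in Mathlib's `RingTheory/Kaehler/JacobiZariski.lean` the following options let unification
-- see through it.
set_option backward.isDefEq.respectTransparency false
set_option backward.defeqAttrib.useBackward true

/-- The tautological presentation of a polynomial algebra: the variables, no relations.
[folklore] -/
noncomputable def polyPresentation (n : ℕ) :
    Algebra.Presentation S (MvPolynomial (Fin n) S) (Fin n) PEmpty.{1} where
  toGenerators := Generators.mvPolynomial S (Fin n)
  relation := PEmpty.elim
  span_range_relation_eq_ker := by
    rw [Generators.ker_mvPolynomial]
    simp

/-- The presentation of a standard étale `S[X₁,…,Xₙ]`-algebra `T` over `S`: generators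
`X₁, …, Xₙ, t, Y`, relations the lifts of `f(t)` and `Y g(t) - 1`. [folklore] -/
noncomputable def presentation (n : ℕ) [Algebra (MvPolynomial (Fin n) S) T]
    [IsScalarTower S (MvPolynomial (Fin n) S) T]
    [Algebra.IsStandardEtale (MvPolynomial (Fin n) S) T] :
    Algebra.Presentation S T (Fin 2 ⊕ Fin n) (Fin 2 ⊕ PEmpty.{1}) :=
  (IsStandardEtale.nonempty_standardEtalePresentation (R := MvPolynomial (Fin n) S)
    (S := T)).some.toPresentation.comp (polyPresentation (S := S) n)

/-- The evaluation `S[X, t, Y] → S[X][t, Y]` of the composite presentation is the canonical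
isomorphism `sumAlgEquiv`. [folklore] -/
lemma aeval_sumElim_eq (n : ℕ) :
    (MvPolynomial.aeval (Sum.elim MvPolynomial.X (MvPolynomial.C ∘ (polyPresentation (S := S) n).val)) :
      MvPolynomial (Fin 2 ⊕ Fin n) S →ₐ[S] MvPolynomial (Fin 2) (MvPolynomial (Fin n) S)) =
      (MvPolynomial.sumAlgEquiv S (Fin 2) (Fin n)).toAlgHom := by
  refine MvPolynomial.algHom_ext fun i => ?_
  rcases i with i | j
  · simp [MvPolynomial.sumAlgEquiv_X_inl]
  · simp [polyPresentation, MvPolynomial.sumAlgEquiv_X_inr]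

/-- The kernel of the presentation is generated by the two relations coming from the standard
étale pair, and these form a Koszul pair. [folklore] -/
theorem ker_presentation_koszul (n : ℕ) [Algebra (MvPolynomial (Fin n) S) T]
    [IsScalarTower S (MvPolynomial (Fin n) S) T]
    [Algebra.IsStandardEtale (MvPolynomial (Fin n) S) T] :
    ∃ p q : (presentation (S := S) (T := T) n).Ring,
      (presentation (S := S) (T := T) n).ker = Ideal.span {p, q} ∧ IsKoszulPair p q := by
  set P₁ := (IsStandardEtale.nonempty_standardEtalePresentation (R := MvPolynomial (Fin n) S)
    (S := T)).some with hP₁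
  set Pc := presentation (S := S) (T := T) n with hPc
  refine ⟨Pc.relation (Sum.inl 0), Pc.relation (Sum.inl 1), ?_, ?_⟩
  · rw [← Pc.span_range_relation_eq_ker]
    congr 1
    ext x
    simp only [Set.mem_range, Set.mem_insert_iff, Set.mem_singleton_iff, Sum.exists,
      IsEmpty.exists_iff, or_false, Fin.exists_fin_two]
    constructor
    · rintro (rfl | rfl)
      · exact Or.inl rfl
      · exact Or.inr rfl
    · rintro (rfl | rfl)
      · exact Or.inl rfl
      · exact Or.inr rfl
  · -- transport the Koszul pair `(f, Y g - 1)` along `S[X,t,Y] ≃ S[X][t][Y]`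
    let Ψ : MvPolynomial (Fin 2 ⊕ Fin n) S ≃ₐ[S] (MvPolynomial (Fin n) S)[X][Y] :=
      (MvPolynomial.sumAlgEquiv S (Fin 2) (Fin n)).trans
        ((Bivariate.equivMvPolynomial (MvPolynomial (Fin n) S)).symm.restrictScalars S)
    have hrel : ∀ r : Fin 2, Ψ (Pc.relation (Sum.inl r)) = ![C P₁.f, Y * C P₁.g - 1] r := by
      intro r
      have h1 := Presentation.comp_aeval_relation_inl P₁.toPresentation (polyPresentation n) r
      rw [aeval_sumElim_eq] at h1
      have h2 : MvPolynomial.sumAlgEquiv S (Fin 2) (Fin n) (Pc.relation (Sum.inl r)) =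
          P₁.toPresentation.relation r := h1
      change (Bivariate.equivMvPolynomial (MvPolynomial (Fin n) S)).symm
        (MvPolynomial.sumAlgEquiv S (Fin 2) (Fin n) (Pc.relation (Sum.inl r))) = _
      rw [h2, StandardEtalePresentation.toPresentation_relation]
      fin_cases r <;> simp
    have hK := (isKoszulPair_standardEtale P₁.monic_f P₁.g).map_ringEquiv Ψ.symm.toRingEquiv
    change IsKoszulPair (Ψ.symm (C P₁.f)) (Ψ.symm (Y * C P₁.g - 1)) at hK
    have h0 : Ψ.symm (C P₁.f) = Pc.relation (Sum.inl 0) := by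
      rw [AlgEquiv.symm_apply_eq, hrel 0]; rfl
    have h1 : Ψ.symm (Y * C P₁.g - 1) = Pc.relation (Sum.inl 1) := by
      rw [AlgEquiv.symm_apply_eq, hrel 1]; rfl
    rw [h0, h1] at hK
    exact hK

/-- **`T ⊗_S H¹(L_{S/R}) = 0` when `T` is standard étale over a polynomial ring over `S`
and `H¹(L_{T/R}) = 0`** (e.g. `T` formally smooth over `R`): the left end of the
Jacobi–Zariski sequence is injective for such `S → T`. [folklore] -/
theorem subsingleton_tensor_h1Cotangent (n : ℕ) [Algebra (MvPolynomial (Fin n) S) T]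
    [IsScalarTower S (MvPolynomial (Fin n) S) T] [Algebra.IsStandardEtale (MvPolynomial (Fin n) S) T]
    [Algebra.FormallySmooth R T] :
    Subsingleton (T ⊗[S] H1Cotangent R S) := by
  haveI : Algebra.Smooth (MvPolynomial (Fin n) S) T := inferInstance
  haveI : Algebra.Smooth S (MvPolynomial (Fin n) S) := ⟨inferInstance, inferInstance⟩
  haveI : Algebra.Smooth S T := Algebra.Smooth.comp S (MvPolynomial (Fin n) S) T
  haveI : Module.Flat S T := inferInstance
  set Q := (presentation (S := S) (T := T) n).toGenerators with hQ
  set P := Generators.self R S with hP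
  obtain ⟨p, q, hker, hK⟩ := ker_presentation_koszul (S := S) (T := T) n
  have hKOS := CotangentInjectivity.kos_of_isKoszulPair Q P hker hK
  haveI : Subsingleton (Q.comp P).toExtension.H1Cotangent :=
    (Generators.equivH1Cotangent (Q.comp P)).toEquiv.subsingleton_congr.mpr inferInstance
  exact CotangentInjectivity.subsingleton_tensor_h1Cotangent Q P hKOS

end StandardEtaleKoszul

end Literature.AlgebraicGeometry.Resolution
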